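import Literature.NumberTheory.BeurlingPrimes.PowerLawAbel
import HarnessLib

/-!
# The hyperbola lemma of Broucke–Debruyne–Révész (arXiv:2309.01567, Lemma 5.1)

Topic `Literature/NumberTheory/BeurlingPrimes`. Everything in this file is PROVED.

**Lemma 5.1** (BDR 2023, p. 14). "Let `𝒩, ℒ` be subsets [allowed to be multisets] of `[1, ∞)`,
`h : ℒ → ℝ⁺`, `a, b ≥ 0`, `0 ≤ γ, δ < β < 1`. If
`N(x) := ∑_{n ≤ x, n ∈ 𝒩} 1 = ax + O(x^γ)`, `L(x) := ∑_{l ≤ x, l ∈ ℒ} h(l) = b x^β + O(x^δ)`, then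
`∑_{nl ≤ x, n ∈ 𝒩, l ∈ ℒ} h(l) = aH(1)x + bI(β)x^β + O(x^{(β−γδ)/(1−γ+β−δ)})`,
where `H(1) = ∑_{l ∈ ℒ} h(l)/l` and
`I(β) = lim_{R → ∞} (∑_{n ≤ R, n ∈ 𝒩} n^{−β} − aR^{1−β}/(1−β))`."

## The formal setting

Both applications of the lemma in BDR §5 have `𝒩 ⊆ ℕ₊` (all integers, resp. the `𝒫_S`-free
integers) and `ℒ` either a weighted subset of `ℕ₊` (`ℒ = 𝒩_S` with `h = μ_S + 1` or `h = 1`) or the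
powers `ℕ^{1/β}` (with `h ≡ 1`). We therefore formalise the lemma for
* `𝒩` = the positive integers weighted by `v : ℕ → ℝ≥0` (`v 0 = 0`; a multiset `𝒩 ⊆ ℕ₊` is the case
  of integer weights), with counting function `N(t) = ∑_{n ≤ t} v n` (`partialSum v`),
* `ℒ` = the points `m^s` (`m ≥ 1`, a fixed real `s ≥ 1`) weighted by `h : ℕ → ℝ≥0` (`h 0 = 0`), with
  counting function `L(u) = ∑_{m^s ≤ u} h m = partialSum h (u^{1/s})`,
and the weighted count `hypConv v h s x = ∑_{n m^s ≤ x} v n · h m`. The hypotheses are the two-sided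
bounds `|N(t) − at| ≤ C_N t^γ` (`t ≥ 1`) and `|L(u) − b u^β| ≤ C_L u^δ` (`u ≥ 1`); the signs of
`a, b` play no role. The conclusion (`hyperbola_lemma`) gives `H(1) = ∑_m h(m) m^{−s}` as a convergent
series (value `hypH h s`), `I(β)` as the printed limit (value `abelConst v a β`,
`Literature/NumberTheory/BeurlingPrimes/PowerLawAbel.lean`), and an explicit constant in the `O`.

## Proof (as printed)

"Let `1 ≤ y ≤ x`. Applying Dirichlet's hyperbola method gives
`∑_{nl ≤ x} h(l) = ∑_{n ≤ y} L(x/n) + ∑_{l ≤ x/y} h(l) N(x/l) − N(y) L(x/y)`" (`hypConv_eq`). "The first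
term delivers `b x^β I(β) + ab x^β y^{1−β}/(1−β) + O(x^β y^{γ−β}) + O(x^δ y^{1−δ})`" (`sigma_one_bound`,
from `abs_sum_mul_rpow_neg_sub_le` and `sum_mul_rpow_neg_le`); "The second term gives
`axH(1) − βab x^β y^{1−β}/(1−β) + O(x^δ y^{1−δ}) + O(x^β y^{γ−β})`" (`sigma_two_bound`, from
`abs_tail_sub_le` and `sum_mul_rpow_neg_le`); "The third term, finally, is
`ab x^β y^{1−β} + O(x^β y^{γ−β}) + O(x^δ y^{1−δ})`" (`sigma_three_bound`). "The result follows after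
optimizing `y = x^{(β−δ)/(1−γ+β−δ)}`" (`hyperbola_lemma`).

## References
* [BrouckeDebruyneRevesz2023] F. Broucke, G. Debruyne, Sz. Gy. Révész, *Some examples of well-behaved
  Beurling number systems*, arXiv:2309.01567 (Trans. AMS 2024), Lemma 5.1 with proof, p. 14 (read).
-/

noncomputable section

open Filter MeasureTheory Set
open scoped Topology

namespace Literature.NumberTheory.BeurlingPrimes

variable (v h : ℕ → ℝ) (s : ℝ)

/-! ### The objects -/

/-- The weighted hyperbola count `∑_{n · m^s ≤ x} v(n) h(m)` over `n, m ≥ 0` (the terms with `n = 0` or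
`m = 0` vanish when `v 0 = h 0 = 0`): BDR's `∑_{nl ≤ x, n ∈ 𝒩, l ∈ ℒ} h(l)` for `𝒩 ⊆ ℕ₊` weighted by `v`
and `ℒ = {m^s}` weighted by `h`. [cite: BrouckeDebruyneRevesz2023, Lemma 5.1] -/
def hypConv (x : ℝ) : ℝ :=
  ∑ n ∈ Finset.Icc 0 ⌊x⌋₊, ∑ m ∈ Finset.Icc 0 ⌊x⌋₊,
    if (n : ℝ) * (m : ℝ) ^ s ≤ x then v n * h m else 0

/-- The value of `H(1) = ∑_{l ∈ ℒ} h(l)/l = ∑_m h(m) m^{−s}` provided by power-law Abel summation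
(`hasSum_mul_rpow_neg`): `s ∫₁^∞ (∑_{m ≤ t} h m) t^{−s−1} dt`. [cite: BrouckeDebruyneRevesz2023, Lemma 5.1] -/
def hypH : ℝ :=
  s * ∫ t in Ioi 1, partialSum h t * t ^ (-s - 1)

/-! ### Elementary helpers -/

/-- Restricting a sum over `[0, M]` by the condition `m ≤ K` (`K ≤ M`). [folklore] -/
theorem sum_Icc_ite_le {M K : ℕ} (hKM : K ≤ M) (f : ℕ → ℝ) :
    ∑ m ∈ Finset.Icc 0 M, (if m ≤ K then f m else 0) = ∑ m ∈ Finset.Icc 0 K, f m := by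
  rw [← Finset.sum_filter]
  congr 1
  ext m
  simp only [Finset.mem_filter, Finset.mem_Icc]
  omega

/-- `x^p (x/y)^q = x^{p+q} y^{−q}` for `x, y > 0`. [folklore] -/
theorem rpow_mul_div_rpow {x y : ℝ} (hx : 0 < x) (hy : 0 < y) (p q : ℝ) :
    x ^ p * (x / y) ^ q = x ^ (p + q) * y ^ (-q) := by
  rw [Real.div_rpow hx.le hy.le, Real.rpow_add hx, Real.rpow_neg hy.le]
  ring

/-- `y^p (x/y)^q = x^{q} y^{p−q}` for `x, y > 0`. [folklore] -/
theorem rpow_mul_div_rpow' {x y : ℝ} (hx : 0 < x) (hy : 0 < y) (p q : ℝ) :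
    y ^ p * (x / y) ^ q = x ^ q * y ^ (p - q) := by
  rw [Real.div_rpow hx.le hy.le, Real.rpow_sub hy]
  ring

/-- `(u^{1/s})^{s e} = u^e` for `u ≥ 0`, `s ≠ 0`. [folklore] -/
theorem rpow_inv_rpow_mul {u s : ℝ} (hu : 0 ≤ u) (hs : s ≠ 0) (e : ℝ) : (u ^ s⁻¹) ^ (s * e) = u ^ e := by
  rw [← Real.rpow_mul hu, show s⁻¹ * (s * e) = e by field_simp]

/-- `(x / m^s)^e = x^e · m^{−s e}` for `x ≥ 0`, `m ≥ 0`. [folklore] -/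
theorem div_rpow_pow {x m s : ℝ} (hx : 0 ≤ x) (hm : 0 ≤ m) (e : ℝ) :
    (x / m ^ s) ^ e = x ^ e * m ^ (-(s * e)) := by
  rw [Real.div_rpow hx (Real.rpow_nonneg hm s), ← Real.rpow_mul hm, Real.rpow_neg hm, div_eq_mul_inv]

/-- The `t`-scale form of the hypothesis on `ℒ`: `|∑_{m ≤ t} h m − b t^{sβ}| ≤ C t^{sδ}` (`t ≥ 1`).
[folklore] -/
theorem partialSum_bound_of_pow {b β δ C : ℝ} (hs : 0 < s)
    (hL : ∀ u, 1 ≤ u → |partialSum h (u ^ s⁻¹) - b * u ^ β| ≤ C * u ^ δ) :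
    ∀ t, 1 ≤ t → |partialSum h t - b * t ^ (s * β)| ≤ C * t ^ (s * δ) := by
  intro t ht
  have ht0 : 0 ≤ t := by linarith
  have hu : 1 ≤ t ^ s := Real.one_le_rpow ht hs.le
  have h := hL (t ^ s) hu
  have h1 : (t ^ s) ^ s⁻¹ = t := by
    rw [← Real.rpow_mul ht0, mul_inv_cancel₀ hs.ne', Real.rpow_one]
  rwa [h1, ← Real.rpow_mul ht0, ← Real.rpow_mul ht0] at h

/-! ### Dirichlet's hyperbola identity -/

/-- **The hyperbola identity** ("Applying Dirichlet's hyperbola method gives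
`∑_{nl ≤ x} h(l) = ∑_{n ≤ y} L(x/n) + ∑_{l ≤ x/y} h(l) N(x/l) − N(y) L(x/y)`", `1 ≤ y ≤ x`).
[cite: BrouckeDebruyneRevesz2023, Lemma 5.1 (proof)] -/
theorem hypConv_eq (hv0 : v 0 = 0) (hh0 : h 0 = 0) (hs : 1 ≤ s) {x y : ℝ} (hy : 1 ≤ y) (hyx : y ≤ x) :
    hypConv v h s x =
      (∑ n ∈ Finset.Icc 0 ⌊y⌋₊, v n * partialSum h ((x / n) ^ s⁻¹)) +
        (∑ m ∈ Finset.Icc 0 ⌊(x / y) ^ s⁻¹⌋₊, h m * partialSum v (x / (m : ℝ) ^ s)) -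
        partialSum v y * partialSum h ((x / y) ^ s⁻¹) := by
  have hx1 : 1 ≤ x := le_trans hy hyx
  have hx0 : 0 < x := by linarith
  have hy0 : 0 < y := by linarith
  have hs0 : 0 < s := by linarith
  have hz1 : 1 ≤ x / y := by rwa [le_div_iff₀ hy0, one_mul]
  have hz0 : 0 < x / y := by positivity
  set X := ⌊x⌋₊ with hX
  set w := (x / y) ^ s⁻¹ with hw
  have hw0 : 0 ≤ w := Real.rpow_nonneg hz0.le _
  have hyX : ⌊y⌋₊ ≤ X := Nat.floor_le_floor hyx
  have hwX : ⌊w⌋₊ ≤ X := by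
    refine Nat.floor_le_floor ?_
    calc w ≤ x / y := Real.rpow_le_self_of_one_le hz1 (inv_le_one_of_one_le₀ hs)
      _ ≤ x := div_le_self hx0.le hy
  -- the pointwise identity of indicators
  have hpt : ∀ n m : ℕ, (if (n : ℝ) * (m : ℝ) ^ s ≤ x then v n * h m else 0) =
      (if (n : ℝ) ≤ y then (if (n : ℝ) * (m : ℝ) ^ s ≤ x then v n * h m else 0) else 0) +
        (if (m : ℝ) ≤ w then (if (n : ℝ) * (m : ℝ) ^ s ≤ x then v n * h m else 0) else 0) -
        (if (n : ℝ) ≤ y then v n else 0) * (if (m : ℝ) ≤ w then h m else 0) := by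
    intro n m
    have hn0 : (0 : ℝ) ≤ n := Nat.cast_nonneg n
    have hm0 : (0 : ℝ) ≤ m := Nat.cast_nonneg m
    have hms0 : (0 : ℝ) ≤ (m : ℝ) ^ s := Real.rpow_nonneg hm0 s
    have hQ : (m : ℝ) ≤ w ↔ (m : ℝ) ^ s ≤ x / y := Real.le_rpow_inv_iff_of_pos hm0 hz0.le hs0
    rw [ite_zero_mul_ite_zero]
    by_cases hP : (n : ℝ) ≤ y
    · by_cases hQ' : (m : ℝ) ≤ w
      · have hR : (n : ℝ) * (m : ℝ) ^ s ≤ x := by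
          calc (n : ℝ) * (m : ℝ) ^ s ≤ y * (x / y) := mul_le_mul hP (hQ.mp hQ') hms0 hy0.le
            _ = x := by field_simp
        rw [if_pos hR, if_pos hP, if_pos hQ', if_pos ⟨hP, hQ'⟩]
        ring
      · rw [if_pos hP, if_neg hQ', if_neg (show ¬((n : ℝ) ≤ y ∧ (m : ℝ) ≤ w) from fun hc ↦ hQ' hc.2)]
        ring
    · by_cases hQ' : (m : ℝ) ≤ w
      · rw [if_neg hP, if_pos hQ', if_neg (show ¬((n : ℝ) ≤ y ∧ (m : ℝ) ≤ w) from fun hc ↦ hP hc.1)]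
        ring
      · have hR : ¬ ((n : ℝ) * (m : ℝ) ^ s ≤ x) := by
          intro hR
          have h1 : x / y < (m : ℝ) ^ s := by
            by_contra h1; exact hQ' (hQ.mpr (not_lt.mp h1))
          have h2 : y < n := not_le.mp hP
          have h3 : x < (n : ℝ) * (m : ℝ) ^ s := by
            calc x = y * (x / y) := by field_simp
              _ < n * (m : ℝ) ^ s := mul_lt_mul'' h2 h1 hy0.le hz0.le
          linarith
        rw [if_neg hR, if_neg hP, if_neg hQ', if_neg (show ¬((n : ℝ) ≤ y ∧ (m : ℝ) ≤ w) from fun hc ↦ hP hc.1)]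
        ring
  -- (e1) the first sum
  have e1 : ∑ n ∈ Finset.Icc 0 X, ∑ m ∈ Finset.Icc 0 X,
      (if (n : ℝ) ≤ y then (if (n : ℝ) * (m : ℝ) ^ s ≤ x then v n * h m else 0) else 0) =
      ∑ n ∈ Finset.Icc 0 ⌊y⌋₊, v n * partialSum h ((x / n) ^ s⁻¹) := by
    have h1 : ∀ n : ℕ, ∑ m ∈ Finset.Icc 0 X,
        (if (n : ℝ) ≤ y then (if (n : ℝ) * (m : ℝ) ^ s ≤ x then v n * h m else 0) else 0) =
        if n ≤ ⌊y⌋₊ then ∑ m ∈ Finset.Icc 0 X, (if (n : ℝ) * (m : ℝ) ^ s ≤ x then v n * h m else 0) else 0 := by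
      intro n
      by_cases hP : (n : ℝ) ≤ y
      · rw [if_pos ((Nat.le_floor_iff hy0.le).mpr hP)]
        exact Finset.sum_congr rfl fun m _ ↦ if_pos hP
      · rw [if_neg (fun hc ↦ hP ((Nat.le_floor_iff hy0.le).mp hc))]
        exact Finset.sum_eq_zero fun m _ ↦ if_neg hP
    rw [Finset.sum_congr rfl fun n _ ↦ h1 n, sum_Icc_ite_le hyX]
    refine Finset.sum_congr rfl fun n _ ↦ ?_
    rcases Nat.eq_zero_or_pos n with hn | hn
    · subst hn
      simp [hv0]
    · have hn0 : (0 : ℝ) < n := by exact_mod_cast hn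
      have hxn : 0 ≤ x / n := by positivity
      -- the condition `n m^s ≤ x` is `m ≤ ⌊(x/n)^{1/s}⌋`
      have hiff : ∀ m : ℕ, ((n : ℝ) * (m : ℝ) ^ s ≤ x) ↔ m ≤ ⌊(x / n) ^ s⁻¹⌋₊ := by
        intro m
        rw [Nat.le_floor_iff (Real.rpow_nonneg hxn _), Real.le_rpow_inv_iff_of_pos (Nat.cast_nonneg m) hxn hs0,
          le_div_iff₀ hn0, mul_comm]
      have hK : ⌊(x / n) ^ s⁻¹⌋₊ ≤ X := by
        refine Nat.floor_le_floor ?_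
        rcases le_or_gt 1 (x / n) with h1 | h1
        · exact (Real.rpow_le_self_of_one_le h1 (inv_le_one_of_one_le₀ hs)).trans (div_le_self hx0.le (by exact_mod_cast hn))
        · exact (Real.rpow_le_one hxn h1.le (inv_nonneg.mpr hs0.le)).trans hx1
      simp only [hiff]
      rw [sum_Icc_ite_le hK, ← Finset.mul_sum]
  -- (e2) the second sum
  have e2 : ∑ n ∈ Finset.Icc 0 X, ∑ m ∈ Finset.Icc 0 X,
      (if (m : ℝ) ≤ w then (if (n : ℝ) * (m : ℝ) ^ s ≤ x then v n * h m else 0) else 0) =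
      ∑ m ∈ Finset.Icc 0 ⌊w⌋₊, h m * partialSum v (x / (m : ℝ) ^ s) := by
    rw [Finset.sum_comm]
    have h1 : ∀ m : ℕ, ∑ n ∈ Finset.Icc 0 X,
        (if (m : ℝ) ≤ w then (if (n : ℝ) * (m : ℝ) ^ s ≤ x then v n * h m else 0) else 0) =
        if m ≤ ⌊w⌋₊ then ∑ n ∈ Finset.Icc 0 X, (if (n : ℝ) * (m : ℝ) ^ s ≤ x then v n * h m else 0) else 0 := by
      intro m
      by_cases hQ : (m : ℝ) ≤ w
      · rw [if_pos ((Nat.le_floor_iff hw0).mpr hQ)]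
        exact Finset.sum_congr rfl fun n _ ↦ if_pos hQ
      · rw [if_neg (fun hc ↦ hQ ((Nat.le_floor_iff hw0).mp hc))]
        exact Finset.sum_eq_zero fun n _ ↦ if_neg hQ
    rw [Finset.sum_congr rfl fun m _ ↦ h1 m, sum_Icc_ite_le hwX]
    refine Finset.sum_congr rfl fun m _ ↦ ?_
    rcases Nat.eq_zero_or_pos m with hm | hm
    · subst hm
      simp [hh0]
    · have hm1 : (1 : ℝ) ≤ m := by exact_mod_cast hm
      have hms : (0 : ℝ) < (m : ℝ) ^ s := Real.rpow_pos_of_pos (by linarith) s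
      have hms1 : (1 : ℝ) ≤ (m : ℝ) ^ s := Real.one_le_rpow hm1 hs0.le
      have hxm : 0 ≤ x / (m : ℝ) ^ s := by positivity
      have hiff : ∀ n : ℕ, ((n : ℝ) * (m : ℝ) ^ s ≤ x) ↔ n ≤ ⌊x / (m : ℝ) ^ s⌋₊ := by
        intro n
        rw [Nat.le_floor_iff hxm, le_div_iff₀ hms]
      have hK : ⌊x / (m : ℝ) ^ s⌋₊ ≤ X := Nat.floor_le_floor (div_le_self hx0.le hms1)
      simp only [hiff]
      rw [sum_Icc_ite_le hK, ← Finset.sum_mul, mul_comm]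
  -- (e3) the third sum
  have e3 : ∑ n ∈ Finset.Icc 0 X, ∑ m ∈ Finset.Icc 0 X,
      (if (n : ℝ) ≤ y then v n else 0) * (if (m : ℝ) ≤ w then h m else 0) =
      partialSum v y * partialSum h w := by
    rw [← Finset.sum_mul_sum]
    have hiff1 : ∀ n : ℕ, ((n : ℝ) ≤ y) ↔ n ≤ ⌊y⌋₊ := fun n ↦ (Nat.le_floor_iff hy0.le).symm
    have hiff2 : ∀ m : ℕ, ((m : ℝ) ≤ w) ↔ m ≤ ⌊w⌋₊ := fun m ↦ (Nat.le_floor_iff hw0).symm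
    simp only [hiff1, hiff2]
    rw [sum_Icc_ite_le hyX, sum_Icc_ite_le hwX]
  -- assemble
  unfold hypConv
  rw [← hX, Finset.sum_congr rfl fun n _ ↦ Finset.sum_congr rfl fun m _ ↦ hpt n m]
  simp only [Finset.sum_sub_distrib, Finset.sum_add_distrib]
  rw [e1, e2, e3]

/-! ### The three estimates -/

/-- **The first term**: `∑_{n ≤ y} v(n) L(x/n) = b I x^β + ab x^β y^{1−β}/(1−β) + O(x^β y^{γ−β}) +
O(x^δ y^{1−δ})` for `1 ≤ y ≤ x`. [cite: BrouckeDebruyneRevesz2023, Lemma 5.1 (proof)] -/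
theorem sigma_one_bound (hv0 : v 0 = 0) (hvnn : ∀ n, 0 ≤ v n) (hs : 1 ≤ s)
    {a b β γ δ C_N C_L : ℝ} (hγ : 0 ≤ γ) (hγβ : γ < β) (hδ : 0 ≤ δ) (hδβ : δ < β) (hβ1 : β < 1)
    (hN : ∀ t, 1 ≤ t → |partialSum v t - a * t| ≤ C_N * t ^ γ)
    (hL : ∀ u, 1 ≤ u → |partialSum h (u ^ s⁻¹) - b * u ^ β| ≤ C_L * u ^ δ) :
    ∃ K : ℝ, ∀ x y : ℝ, 1 ≤ y → y ≤ x →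
      |(∑ n ∈ Finset.Icc 0 ⌊y⌋₊, v n * partialSum h ((x / n) ^ s⁻¹)) -
          (b * abelConst v a β * x ^ β + a * b / (1 - β) * (x ^ β * y ^ (1 - β)))|
        ≤ K * (x ^ β * y ^ (γ - β) + x ^ δ * y ^ (1 - δ)) := by
  have hs0 : 0 < s := by linarith
  have hδ1 : δ < 1 := by linarith
  have hCN : 0 ≤ C_N := by
    have h1 := hN 1 le_rfl
    simp only [Real.one_rpow, mul_one] at h1
    exact le_trans (abs_nonneg _) h1
  have hCL : 0 ≤ C_L := by
    have h1 := hL 1 le_rfl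
    simp only [Real.one_rpow, mul_one] at h1
    exact le_trans (abs_nonneg _) h1
  -- the linear upper bound for `N`
  have hNle : ∀ t, 1 ≤ t → partialSum v t ≤ (|a| + C_N) * t ^ (1 : ℝ) := by
    intro t ht
    have h1 := hN t ht
    have ht0 : 0 ≤ t := by linarith
    have h2 : C_N * t ^ γ ≤ C_N * t := by
      calc C_N * t ^ γ ≤ C_N * t ^ (1 : ℝ) := mul_le_mul_of_nonneg_left
            (Real.rpow_le_rpow_of_exponent_le ht (by linarith)) hCN
        _ = C_N * t := by rw [Real.rpow_one]
    rw [Real.rpow_one]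
    have h3 : a * t ≤ |a| * t := mul_le_mul_of_nonneg_right (le_abs_self a) ht0
    have h4 := (abs_le.mp h1).2
    linarith
  set K₁ : ℝ := |b| * (C_N * (1 + β / (β - γ))) with hK₁
  set K₂ : ℝ := C_L * ((|a| + C_N) * (1 / (1 - δ))) with hK₂
  refine ⟨K₁ + K₂, fun x y hy hyx ↦ ?_⟩
  have hx1 : 1 ≤ x := le_trans hy hyx
  have hx0 : 0 < x := by linarith
  have hy0 : 0 < y := by linarith
  set Sβ : ℝ := ∑ n ∈ Finset.Icc 0 ⌊y⌋₊, v n * (n : ℝ) ^ (-β) with hSβ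
  set Sδ : ℝ := ∑ n ∈ Finset.Icc 0 ⌊y⌋₊, v n * (n : ℝ) ^ (-δ) with hSδ
  -- Step A: `|Σ₁ − b x^β Sβ| ≤ C_L x^δ Sδ`
  have hA : |(∑ n ∈ Finset.Icc 0 ⌊y⌋₊, v n * partialSum h ((x / n) ^ s⁻¹)) - b * x ^ β * Sβ|
      ≤ C_L * x ^ δ * Sδ := by
    rw [hSβ, hSδ, Finset.mul_sum, Finset.mul_sum, ← Finset.sum_sub_distrib]
    refine (Finset.abs_sum_le_sum_abs _ _).trans (Finset.sum_le_sum fun n hn ↦ ?_)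
    rcases Nat.eq_zero_or_pos n with hn0 | hnpos
    · subst hn0; simp [hv0]
    · have hnr : (0 : ℝ) < n := by exact_mod_cast hnpos
      have hny : (n : ℝ) ≤ y := (Nat.le_floor_iff hy0.le).mp (Finset.mem_Icc.mp hn).2
      have hu : 1 ≤ x / n := by rw [le_div_iff₀ hnr, one_mul]; linarith
      have h1 := hL (x / n) hu
      have e1 : (x / n) ^ β = x ^ β * (n : ℝ) ^ (-β) := by
        rw [Real.div_rpow hx0.le hnr.le, Real.rpow_neg hnr.le, div_eq_mul_inv]
      have e2 : (x / n) ^ δ = x ^ δ * (n : ℝ) ^ (-δ) := by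
        rw [Real.div_rpow hx0.le hnr.le, Real.rpow_neg hnr.le, div_eq_mul_inv]
      have e3 : v n * partialSum h ((x / n) ^ s⁻¹) - b * x ^ β * (v n * (n : ℝ) ^ (-β)) =
          v n * (partialSum h ((x / n) ^ s⁻¹) - b * (x / n) ^ β) := by rw [e1]; ring
      rw [e3, abs_mul, abs_of_nonneg (hvnn n)]
      calc v n * |partialSum h ((x / n) ^ s⁻¹) - b * (x / n) ^ β| ≤ v n * (C_L * (x / n) ^ δ) :=
            mul_le_mul_of_nonneg_left h1 (hvnn n)
        _ = C_L * x ^ δ * (v n * (n : ℝ) ^ (-δ)) := by rw [e2]; ring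
  -- Step B: AB2 for `Sβ`
  have hB := abs_sum_mul_rpow_neg_sub_le v hv0 hγ hγβ hβ1 hN hy
  rw [← hSβ] at hB
  -- Step C: AB1 for `Sδ`
  have hC : Sδ ≤ (|a| + C_N) * (1 / (1 - δ)) * y ^ (1 - δ) := by
    have h := sum_mul_rpow_neg_le v hv0 hvnn hδ hδ1 hNle hy
    rwa [← hSδ] at h
  -- combine
  have hSδ0 : 0 ≤ Sδ := Finset.sum_nonneg fun n _ ↦ mul_nonneg (hvnn n) (Real.rpow_nonneg (Nat.cast_nonneg n) _)
  have hxβ : 0 ≤ x ^ β := Real.rpow_nonneg hx0.le _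
  have hxδ : 0 ≤ x ^ δ := Real.rpow_nonneg hx0.le _
  have hm1 : 0 ≤ x ^ β * y ^ (γ - β) := mul_nonneg hxβ (Real.rpow_nonneg hy0.le _)
  have hm2 : 0 ≤ x ^ δ * y ^ (1 - δ) := mul_nonneg hxδ (Real.rpow_nonneg hy0.le _)
  have hdecomp : (∑ n ∈ Finset.Icc 0 ⌊y⌋₊, v n * partialSum h ((x / n) ^ s⁻¹)) -
      (b * abelConst v a β * x ^ β + a * b / (1 - β) * (x ^ β * y ^ (1 - β))) =
      ((∑ n ∈ Finset.Icc 0 ⌊y⌋₊, v n * partialSum h ((x / n) ^ s⁻¹)) - b * x ^ β * Sβ) +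
        b * x ^ β * (Sβ - (a / (1 - β) * y ^ (1 - β) + abelConst v a β)) := by ring
  rw [hdecomp]
  refine (abs_add_le _ _).trans ?_
  have h2 : |b * x ^ β * (Sβ - (a / (1 - β) * y ^ (1 - β) + abelConst v a β))| ≤ K₁ * (x ^ β * y ^ (γ - β)) := by
    rw [abs_mul, abs_mul, abs_of_nonneg hxβ]
    calc |b| * x ^ β * |Sβ - (a / (1 - β) * y ^ (1 - β) + abelConst v a β)|
        ≤ |b| * x ^ β * (C_N * (1 + β / (β - γ)) * y ^ (γ - β)) :=
          mul_le_mul_of_nonneg_left hB (mul_nonneg (abs_nonneg b) hxβ)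
      _ = K₁ * (x ^ β * y ^ (γ - β)) := by rw [hK₁]; ring
  have h1 : |(∑ n ∈ Finset.Icc 0 ⌊y⌋₊, v n * partialSum h ((x / n) ^ s⁻¹)) - b * x ^ β * Sβ|
      ≤ K₂ * (x ^ δ * y ^ (1 - δ)) := by
    refine hA.trans ?_
    calc C_L * x ^ δ * Sδ ≤ C_L * x ^ δ * ((|a| + C_N) * (1 / (1 - δ)) * y ^ (1 - δ)) :=
          mul_le_mul_of_nonneg_left hC (mul_nonneg hCL hxδ)
      _ = K₂ * (x ^ δ * y ^ (1 - δ)) := by rw [hK₂]; ring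
  have hK₁0 : 0 ≤ K₁ := by
    rw [hK₁]
    refine mul_nonneg (abs_nonneg b) (mul_nonneg hCN ?_)
    have : 0 ≤ β / (β - γ) := div_nonneg (by linarith) (by linarith)
    linarith
  have hK₂0 : 0 ≤ K₂ := by
    rw [hK₂]
    refine mul_nonneg hCL (mul_nonneg (by positivity) ?_)
    exact div_nonneg zero_le_one (by linarith)
  calc |(∑ n ∈ Finset.Icc 0 ⌊y⌋₊, v n * partialSum h ((x / n) ^ s⁻¹)) - b * x ^ β * Sβ| +
        |b * x ^ β * (Sβ - (a / (1 - β) * y ^ (1 - β) + abelConst v a β))|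
      ≤ K₂ * (x ^ δ * y ^ (1 - δ)) + K₁ * (x ^ β * y ^ (γ - β)) := add_le_add h1 h2
    _ ≤ (K₁ + K₂) * (x ^ β * y ^ (γ - β) + x ^ δ * y ^ (1 - δ)) := by
        linarith [mul_nonneg hK₁0 hm2, mul_nonneg hK₂0 hm1]

/-- **The second term**: `∑_{l ≤ x/y} h(l) N(x/l) = axH(1) − βab x^β y^{1−β}/(1−β) + O(x^δ y^{1−δ}) +
O(x^β y^{γ−β})` for `1 ≤ y ≤ x`. [cite: BrouckeDebruyneRevesz2023, Lemma 5.1 (proof)] -/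
theorem sigma_two_bound (hh0 : h 0 = 0) (hhnn : ∀ m, 0 ≤ h m) (hs : 1 ≤ s)
    {a b β γ δ C_N C_L : ℝ} (hγ : 0 ≤ γ) (hγβ : γ < β) (hδ : 0 ≤ δ) (hδβ : δ < β) (hβ1 : β < 1)
    (hN : ∀ t, 1 ≤ t → |partialSum v t - a * t| ≤ C_N * t ^ γ)
    (hL : ∀ u, 1 ≤ u → |partialSum h (u ^ s⁻¹) - b * u ^ β| ≤ C_L * u ^ δ) :
    ∃ K : ℝ, ∀ x y : ℝ, 1 ≤ y → y ≤ x →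
      |(∑ m ∈ Finset.Icc 0 ⌊(x / y) ^ s⁻¹⌋₊, h m * partialSum v (x / (m : ℝ) ^ s)) -
          (a * hypH h s * x - a * b * β / (1 - β) * (x ^ β * y ^ (1 - β)))|
        ≤ K * (x ^ β * y ^ (γ - β) + x ^ δ * y ^ (1 - δ)) := by
  have hs0 : 0 < s := by linarith
  have hsne : s ≠ 0 := hs0.ne'
  have hCN : 0 ≤ C_N := by
    have h1 := hN 1 le_rfl
    simp only [Real.one_rpow, mul_one] at h1
    exact le_trans (abs_nonneg _) h1
  have hCL : 0 ≤ C_L := by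
    have h1 := hL 1 le_rfl
    simp only [Real.one_rpow, mul_one] at h1
    exact le_trans (abs_nonneg _) h1
  -- `t`-scale hypothesis on `ℒ` and its consequences
  have hLt := partialSum_bound_of_pow h s hs0 hL
  have hτ : 0 ≤ s * δ := mul_nonneg hs0.le hδ
  have hτρ : s * δ < s * β := mul_lt_mul_of_pos_left hδβ hs0
  have hρl : s * β < s := mul_lt_of_lt_one_right hs0 hβ1
  have hsδ : s * δ < s := mul_lt_of_lt_one_right hs0 (by linarith)
  have hγρ : s * γ < s * β := mul_lt_mul_of_pos_left hγβ hs0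
  have hHle : ∀ t, 1 ≤ t → partialSum h t ≤ (|b| + C_L) * t ^ (s * β) := fun t ht ↦
    le_trans (le_abs_self _) (abs_partialSum_le_of_error_bound h hτρ.le hLt ht)
  set K₁ : ℝ := C_N * ((|b| + C_L) * (s * β / (s * β - s * γ))) with hK₁
  set K₂ : ℝ := |a| * (C_L * (1 + s / (s - s * δ))) with hK₂
  refine ⟨K₁ + K₂, fun x y hy hyx ↦ ?_⟩
  have hx1 : 1 ≤ x := le_trans hy hyx
  have hx0 : 0 < x := by linarith
  have hy0 : 0 < y := by linarith
  have hz1 : 1 ≤ x / y := by rwa [le_div_iff₀ hy0, one_mul]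
  have hz0 : 0 < x / y := by positivity
  set w := (x / y) ^ s⁻¹ with hw
  have hw1 : 1 ≤ w := Real.one_le_rpow hz1 (inv_nonneg.mpr hs0.le)
  have hw0 : 0 < w := by linarith
  have hws : w ^ s = x / y := by
    rw [hw, ← Real.rpow_mul hz0.le, inv_mul_cancel₀ hsne, Real.rpow_one]
  set Ts : ℝ := ∑ m ∈ Finset.Icc 0 ⌊w⌋₊, h m * (m : ℝ) ^ (-s) with hTs
  set Tγ : ℝ := ∑ m ∈ Finset.Icc 0 ⌊w⌋₊, h m * (m : ℝ) ^ (-(s * γ)) with hTγ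
  -- Step A: `|Σ₂ − a x Ts| ≤ C_N x^γ Tγ`
  have hA : |(∑ m ∈ Finset.Icc 0 ⌊w⌋₊, h m * partialSum v (x / (m : ℝ) ^ s)) - a * x * Ts|
      ≤ C_N * x ^ γ * Tγ := by
    rw [hTs, hTγ, Finset.mul_sum, Finset.mul_sum, ← Finset.sum_sub_distrib]
    refine (Finset.abs_sum_le_sum_abs _ _).trans (Finset.sum_le_sum fun m hm ↦ ?_)
    rcases Nat.eq_zero_or_pos m with hm0 | hmpos
    · subst hm0; simp [hh0]
    · have hmr : (0 : ℝ) < m := by exact_mod_cast hmpos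
      have hms : (0 : ℝ) < (m : ℝ) ^ s := Real.rpow_pos_of_pos hmr s
      have hmw : (m : ℝ) ≤ w := (Nat.le_floor_iff hw0.le).mp (Finset.mem_Icc.mp hm).2
      have hmsz : (m : ℝ) ^ s ≤ x / y := by
        rw [← hws]; exact Real.rpow_le_rpow hmr.le hmw hs0.le
      have hu : 1 ≤ x / (m : ℝ) ^ s := by
        rw [le_div_iff₀ hms, one_mul]
        calc (m : ℝ) ^ s ≤ x / y := hmsz
          _ ≤ x := div_le_self hx0.le hy
        -- in fact `x/m^s ≥ y ≥ 1`; the weaker bound suffices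
      have h1 := hN (x / (m : ℝ) ^ s) hu
      have e1 : a * (x / (m : ℝ) ^ s) = a * x * (m : ℝ) ^ (-s) := by
        rw [Real.rpow_neg hmr.le, div_eq_mul_inv]; ring
      have e2 : (x / (m : ℝ) ^ s) ^ γ = x ^ γ * (m : ℝ) ^ (-(s * γ)) := div_rpow_pow hx0.le hmr.le γ
      have e3 : h m * partialSum v (x / (m : ℝ) ^ s) - a * x * (h m * (m : ℝ) ^ (-s)) =
          h m * (partialSum v (x / (m : ℝ) ^ s) - a * (x / (m : ℝ) ^ s)) := by rw [e1]; ring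
      rw [e3, abs_mul, abs_of_nonneg (hhnn m)]
      calc h m * |partialSum v (x / (m : ℝ) ^ s) - a * (x / (m : ℝ) ^ s)| ≤ h m * (C_N * (x / (m : ℝ) ^ s) ^ γ) :=
            mul_le_mul_of_nonneg_left h1 (hhnn m)
        _ = C_N * x ^ γ * (h m * (m : ℝ) ^ (-(s * γ))) := by rw [e2]; ring
  -- Step B: the tail of `H(1)` (AB3)
  have hB := abs_tail_sub_le h hh0 hτ hτρ hρl hLt hw1
  rw [← hTs] at hB
  have eB1 : b * (s * β) / (s - s * β) * w ^ (s * β - s) = b * β / (1 - β) * (x / y) ^ (β - 1) := by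
    have : w ^ (s * β - s) = (x / y) ^ (β - 1) := by
      rw [show s * β - s = s * (β - 1) by ring, hw, rpow_inv_rpow_mul hz0.le hsne]
    rw [this]
    have h1b : (1 - β) ≠ 0 := by linarith
    have hss : (s - s * β) = s * (1 - β) := by ring
    rw [hss]
    field_simp
  have eB2 : w ^ (s * δ - s) = (x / y) ^ (δ - 1) := by
    rw [show s * δ - s = s * (δ - 1) by ring, hw, rpow_inv_rpow_mul hz0.le hsne]
  rw [eB1, eB2] at hB
  -- so `hB : |hypH − Ts − bβ/(1−β) (x/y)^{β−1}| ≤ C_L (1 + s/(s − sδ)) (x/y)^{δ−1}`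
  -- Step C: AB1 for `Tγ`
  have hC : Tγ ≤ (|b| + C_L) * (s * β / (s * β - s * γ)) * w ^ (s * β - s * γ) := by
    have h := sum_mul_rpow_neg_le h hh0 hhnn (mul_nonneg hs0.le hγ) hγρ hHle hw1
    rwa [← hTγ] at h
  have eC : w ^ (s * β - s * γ) = (x / y) ^ (β - γ) := by
    rw [show s * β - s * γ = s * (β - γ) by ring, hw, rpow_inv_rpow_mul hz0.le hsne]
  rw [eC] at hC
  -- monomial identities
  have em1 : x ^ γ * (x / y) ^ (β - γ) = x ^ β * y ^ (γ - β) := by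
    rw [rpow_mul_div_rpow hx0 hy0, show γ + (β - γ) = β by ring, show -(β - γ) = γ - β by ring]
  have em2 : x * (x / y) ^ (δ - 1) = x ^ δ * y ^ (1 - δ) := by
    have h1 := rpow_mul_div_rpow hx0 hy0 1 (δ - 1)
    rw [Real.rpow_one, show (1 : ℝ) + (δ - 1) = δ by ring, show -(δ - 1) = 1 - δ by ring] at h1
    exact h1
  have em3 : x * (x / y) ^ (β - 1) = x ^ β * y ^ (1 - β) := by
    have h1 := rpow_mul_div_rpow hx0 hy0 1 (β - 1)
    rw [Real.rpow_one, show (1 : ℝ) + (β - 1) = β by ring, show -(β - 1) = 1 - β by ring] at h1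
    exact h1
  -- combine
  have hxγ : 0 ≤ x ^ γ := Real.rpow_nonneg hx0.le _
  have hm1 : 0 ≤ x ^ β * y ^ (γ - β) := mul_nonneg (Real.rpow_nonneg hx0.le _) (Real.rpow_nonneg hy0.le _)
  have hm2 : 0 ≤ x ^ δ * y ^ (1 - δ) := mul_nonneg (Real.rpow_nonneg hx0.le _) (Real.rpow_nonneg hy0.le _)
  set R : ℝ := hypH h s - Ts - b * β / (1 - β) * (x / y) ^ (β - 1) with hR
  have hdecomp : (∑ m ∈ Finset.Icc 0 ⌊w⌋₊, h m * partialSum v (x / (m : ℝ) ^ s)) -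
      (a * hypH h s * x - a * b * β / (1 - β) * (x ^ β * y ^ (1 - β))) =
      ((∑ m ∈ Finset.Icc 0 ⌊w⌋₊, h m * partialSum v (x / (m : ℝ) ^ s)) - a * x * Ts) - a * x * R := by
    rw [hR, ← em3]; ring
  rw [hdecomp]
  refine (abs_sub _ _).trans ?_
  have h1 : |(∑ m ∈ Finset.Icc 0 ⌊w⌋₊, h m * partialSum v (x / (m : ℝ) ^ s)) - a * x * Ts|
      ≤ K₁ * (x ^ β * y ^ (γ - β)) := by
    refine hA.trans ?_
    calc C_N * x ^ γ * Tγ ≤ C_N * x ^ γ * ((|b| + C_L) * (s * β / (s * β - s * γ)) * (x / y) ^ (β - γ)) :=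
          mul_le_mul_of_nonneg_left hC (mul_nonneg hCN hxγ)
      _ = K₁ * (x ^ γ * (x / y) ^ (β - γ)) := by rw [hK₁]; ring
      _ = K₁ * (x ^ β * y ^ (γ - β)) := by rw [em1]
  have h2 : |a * x * R| ≤ K₂ * (x ^ δ * y ^ (1 - δ)) := by
    rw [abs_mul, abs_mul, abs_of_pos hx0]
    have hRb : |R| ≤ C_L * (1 + s / (s - s * δ)) * (x / y) ^ (δ - 1) := by
      rw [hR]; unfold hypH; exact hB
    calc |a| * x * |R| ≤ |a| * x * (C_L * (1 + s / (s - s * δ)) * (x / y) ^ (δ - 1)) :=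
          mul_le_mul_of_nonneg_left hRb (mul_nonneg (abs_nonneg a) hx0.le)
      _ = K₂ * (x * (x / y) ^ (δ - 1)) := by rw [hK₂]; ring
      _ = K₂ * (x ^ δ * y ^ (1 - δ)) := by rw [em2]
  have hK₁0 : 0 ≤ K₁ := by
    rw [hK₁]
    refine mul_nonneg hCN (mul_nonneg (by positivity) (div_nonneg ?_ ?_))
    · exact mul_nonneg hs0.le (by linarith)
    · linarith
  have hK₂0 : 0 ≤ K₂ := by
    rw [hK₂]
    refine mul_nonneg (abs_nonneg a) (mul_nonneg hCL ?_)
    have : 0 ≤ s / (s - s * δ) := div_nonneg hs0.le (by linarith)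
    linarith
  calc |(∑ m ∈ Finset.Icc 0 ⌊w⌋₊, h m * partialSum v (x / (m : ℝ) ^ s)) - a * x * Ts| + |a * x * R|
      ≤ K₁ * (x ^ β * y ^ (γ - β)) + K₂ * (x ^ δ * y ^ (1 - δ)) := add_le_add h1 h2
    _ ≤ (K₁ + K₂) * (x ^ β * y ^ (γ - β) + x ^ δ * y ^ (1 - δ)) := by
        linarith [mul_nonneg hK₁0 hm2, mul_nonneg hK₂0 hm1]

/-- **The third term**: `N(y) L(x/y) = ab x^β y^{1−β} + O(x^β y^{γ−β}) + O(x^δ y^{1−δ})` for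
`1 ≤ y ≤ x`. [cite: BrouckeDebruyneRevesz2023, Lemma 5.1 (proof)] -/
theorem sigma_three_bound (hs : 1 ≤ s)
    {a b β γ δ C_N C_L : ℝ} (hγ1 : γ ≤ 1)
    (hN : ∀ t, 1 ≤ t → |partialSum v t - a * t| ≤ C_N * t ^ γ)
    (hL : ∀ u, 1 ≤ u → |partialSum h (u ^ s⁻¹) - b * u ^ β| ≤ C_L * u ^ δ) :
    ∃ K : ℝ, ∀ x y : ℝ, 1 ≤ y → y ≤ x →
      |partialSum v y * partialSum h ((x / y) ^ s⁻¹) - a * b * (x ^ β * y ^ (1 - β))|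
        ≤ K * (x ^ β * y ^ (γ - β) + x ^ δ * y ^ (1 - δ)) := by
  have hs0 : 0 < s := by linarith
  have hCN : 0 ≤ C_N := by
    have h1 := hN 1 le_rfl
    simp only [Real.one_rpow, mul_one] at h1
    exact le_trans (abs_nonneg _) h1
  have hCL : 0 ≤ C_L := by
    have h1 := hL 1 le_rfl
    simp only [Real.one_rpow, mul_one] at h1
    exact le_trans (abs_nonneg _) h1
  refine ⟨|a| * C_L + C_N * |b| + C_N * C_L, fun x y hy hyx ↦ ?_⟩
  have hx1 : 1 ≤ x := le_trans hy hyx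
  have hx0 : 0 < x := by linarith
  have hy0 : 0 < y := by linarith
  have hz1 : 1 ≤ x / y := by rwa [le_div_iff₀ hy0, one_mul]
  have hz0 : 0 < x / y := by positivity
  set EN : ℝ := partialSum v y - a * y with hEN
  set EL : ℝ := partialSum h ((x / y) ^ s⁻¹) - b * (x / y) ^ β with hEL
  have hENb : |EN| ≤ C_N * y ^ γ := hN y hy
  have hELb : |EL| ≤ C_L * (x / y) ^ δ := hL (x / y) hz1
  -- monomials
  have em1 : y * (x / y) ^ β = x ^ β * y ^ (1 - β) := by
    have h1 := rpow_mul_div_rpow' hx0 hy0 1 β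
    rwa [Real.rpow_one] at h1
  have em2 : y * (x / y) ^ δ = x ^ δ * y ^ (1 - δ) := by
    have h1 := rpow_mul_div_rpow' hx0 hy0 1 δ
    rwa [Real.rpow_one] at h1
  have em3 : y ^ γ * (x / y) ^ β = x ^ β * y ^ (γ - β) := rpow_mul_div_rpow' hx0 hy0 γ β
  have em4 : y ^ γ * (x / y) ^ δ = x ^ δ * y ^ (γ - δ) := rpow_mul_div_rpow' hx0 hy0 γ δ
  have hyγδ : y ^ (γ - δ) ≤ y ^ (1 - δ) := Real.rpow_le_rpow_of_exponent_le hy (by linarith)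
  have hdecomp : partialSum v y * partialSum h ((x / y) ^ s⁻¹) - a * b * (x ^ β * y ^ (1 - β)) =
      a * (y * EL) + b * (EN * (x / y) ^ β) + EN * EL := by
    rw [← em1, hEN, hEL]; ring
  rw [hdecomp]
  have hzβ : 0 ≤ (x / y) ^ β := Real.rpow_nonneg hz0.le _
  have hzδ : 0 ≤ (x / y) ^ δ := Real.rpow_nonneg hz0.le _
  have hyγ : 0 ≤ y ^ γ := Real.rpow_nonneg hy0.le _
  have hxδ : 0 ≤ x ^ δ := Real.rpow_nonneg hx0.le _
  have h1 : |a * (y * EL)| ≤ |a| * C_L * (x ^ δ * y ^ (1 - δ)) := by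
    rw [abs_mul, abs_mul, abs_of_pos hy0]
    calc |a| * (y * |EL|) ≤ |a| * (y * (C_L * (x / y) ^ δ)) :=
          mul_le_mul_of_nonneg_left (mul_le_mul_of_nonneg_left hELb hy0.le) (abs_nonneg a)
      _ = |a| * C_L * (y * (x / y) ^ δ) := by ring
      _ = |a| * C_L * (x ^ δ * y ^ (1 - δ)) := by rw [em2]
  have h2 : |b * (EN * (x / y) ^ β)| ≤ C_N * |b| * (x ^ β * y ^ (γ - β)) := by
    rw [abs_mul, abs_mul, abs_of_nonneg hzβ]
    calc |b| * (|EN| * (x / y) ^ β) ≤ |b| * (C_N * y ^ γ * (x / y) ^ β) :=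
          mul_le_mul_of_nonneg_left (mul_le_mul_of_nonneg_right hENb hzβ) (abs_nonneg b)
      _ = C_N * |b| * (y ^ γ * (x / y) ^ β) := by ring
      _ = C_N * |b| * (x ^ β * y ^ (γ - β)) := by rw [em3]
  have h3 : |EN * EL| ≤ C_N * C_L * (x ^ δ * y ^ (1 - δ)) := by
    rw [abs_mul]
    calc |EN| * |EL| ≤ C_N * y ^ γ * (C_L * (x / y) ^ δ) :=
          mul_le_mul hENb hELb (abs_nonneg _) (mul_nonneg hCN hyγ)
      _ = C_N * C_L * (y ^ γ * (x / y) ^ δ) := by ring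
      _ = C_N * C_L * (x ^ δ * y ^ (γ - δ)) := by rw [em4]
      _ ≤ C_N * C_L * (x ^ δ * y ^ (1 - δ)) :=
          mul_le_mul_of_nonneg_left (mul_le_mul_of_nonneg_left hyγδ hxδ) (mul_nonneg hCN hCL)
  have hm1 : 0 ≤ x ^ β * y ^ (γ - β) := mul_nonneg (Real.rpow_nonneg hx0.le _) (Real.rpow_nonneg hy0.le _)
  have hm2 : 0 ≤ x ^ δ * y ^ (1 - δ) := mul_nonneg hxδ (Real.rpow_nonneg hy0.le _)
  have haC : 0 ≤ |a| * C_L := mul_nonneg (abs_nonneg a) hCL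
  have hbC : 0 ≤ C_N * |b| := mul_nonneg hCN (abs_nonneg b)
  have hCC : 0 ≤ C_N * C_L := mul_nonneg hCN hCL
  calc |a * (y * EL) + b * (EN * (x / y) ^ β) + EN * EL|
      ≤ |a * (y * EL)| + |b * (EN * (x / y) ^ β)| + |EN * EL| := abs_add_three _ _ _
    _ ≤ |a| * C_L * (x ^ δ * y ^ (1 - δ)) + C_N * |b| * (x ^ β * y ^ (γ - β)) + C_N * C_L * (x ^ δ * y ^ (1 - δ)) :=
        add_le_add (add_le_add h1 h2) h3
    _ ≤ (|a| * C_L + C_N * |b| + C_N * C_L) * (x ^ β * y ^ (γ - β) + x ^ δ * y ^ (1 - δ)) := by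
        linarith [mul_nonneg haC hm1, mul_nonneg hbC hm2, mul_nonneg hCC hm1]

/-! ### Lemma 5.1 -/

/-- **Broucke–Debruyne–Révész 2023, Lemma 5.1** (hyperbola lemma), in the setting of this file:
let `v, h : ℕ → ℝ≥0` with `v 0 = h 0 = 0`, `s ≥ 1`, `0 ≤ γ < β`, `0 ≤ δ < β < 1`, and suppose
`|N(t) − at| ≤ C_N t^γ` (`t ≥ 1`, `N = ∑_{n ≤ t} v n`) and `|L(u) − b u^β| ≤ C_L u^δ` (`u ≥ 1`,
`L(u) = ∑_{m^s ≤ u} h m`). Then `H(1) = ∑_m h(m) m^{−s}` converges (to `hypH h s`),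
`I(β) = lim_R (∑_{n ≤ R} v(n) n^{−β} − aR^{1−β}/(1−β))` exists (`= abelConst v a β`), and for `x ≥ 1`
`|∑_{n m^s ≤ x} v(n) h(m) − (a H(1) x + b I(β) x^β)| ≤ C x^{(β−γδ)/(1−γ+β−δ)}`.
[cite: BrouckeDebruyneRevesz2023, Lemma 5.1] -/
theorem hyperbola_lemma (hv0 : v 0 = 0) (hvnn : ∀ n, 0 ≤ v n) (hh0 : h 0 = 0) (hhnn : ∀ m, 0 ≤ h m)
    (hs : 1 ≤ s) {a b β γ δ C_N C_L : ℝ} (hγ : 0 ≤ γ) (hγβ : γ < β) (hδ : 0 ≤ δ) (hδβ : δ < β)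
    (hβ1 : β < 1) (hN : ∀ t, 1 ≤ t → |partialSum v t - a * t| ≤ C_N * t ^ γ)
    (hL : ∀ u, 1 ≤ u → |partialSum h (u ^ s⁻¹) - b * u ^ β| ≤ C_L * u ^ δ) :
    HasSum (fun m ↦ h m * (m : ℝ) ^ (-s)) (hypH h s) ∧
      Tendsto (fun R : ℕ ↦ ∑ n ∈ Finset.Icc 0 R, v n * (n : ℝ) ^ (-β) - a / (1 - β) * (R : ℝ) ^ (1 - β))
        atTop (𝓝 (abelConst v a β)) ∧
      ∃ C : ℝ, ∀ x : ℝ, 1 ≤ x →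
        |hypConv v h s x - (a * hypH h s * x + b * abelConst v a β * x ^ β)|
          ≤ C * x ^ ((β - γ * δ) / (1 - γ + β - δ)) := by
  have hs0 : 0 < s := by linarith
  have hLt := partialSum_bound_of_pow h s hs0 hL
  refine ⟨?_, tendsto_sum_mul_rpow_neg_sub v hv0 hγ hγβ hβ1 hN, ?_⟩
  · exact hasSum_mul_rpow_neg h hh0 hhnn (mul_nonneg hs0.le hδ) (mul_lt_mul_of_pos_left hδβ hs0)
      (mul_lt_of_lt_one_right hs0 hβ1) hLt
  obtain ⟨K₁, hK₁⟩ := sigma_one_bound v h s hv0 hvnn hs hγ hγβ hδ hδβ hβ1 hN hL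
  obtain ⟨K₂, hK₂⟩ := sigma_two_bound v h s hh0 hhnn hs hγ hγβ hδ hδβ hβ1 hN hL
  obtain ⟨K₃, hK₃⟩ := sigma_three_bound v h s hs (by linarith) hN hL
  refine ⟨2 * (K₁ + K₂ + K₃), fun x hx1 ↦ ?_⟩
  have hx0 : 0 < x := by linarith
  -- the optimal `y = x^η`
  set D : ℝ := 1 - γ + β - δ with hD
  have hD0 : 0 < D := by rw [hD]; linarith
  set η : ℝ := (β - δ) / D with hη
  have hη0 : 0 ≤ η := div_nonneg (by linarith) hD0.le
  have hη1 : η ≤ 1 := by rw [hη, div_le_one hD0, hD]; linarith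
  set y : ℝ := x ^ η with hy
  have hy1 : 1 ≤ y := Real.one_le_rpow hx1 hη0
  have hyx : y ≤ x := by
    calc y = x ^ η := rfl
      _ ≤ x ^ (1 : ℝ) := Real.rpow_le_rpow_of_exponent_le hx1 hη1
      _ = x := Real.rpow_one x
  have hy0 : 0 < y := by linarith
  -- both error monomials equal `x^θ`
  have hDne : (1 - γ + β - δ) ≠ 0 := by linarith
  have hθ1 : x ^ β * y ^ (γ - β) = x ^ ((β - γ * δ) / D) := by
    rw [hy, ← Real.rpow_mul hx0.le, ← Real.rpow_add hx0]
    congr 1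
    rw [hη, hD]
    field_simp
    ring
  have hθ2 : x ^ δ * y ^ (1 - δ) = x ^ ((β - γ * δ) / D) := by
    rw [hy, ← Real.rpow_mul hx0.le, ← Real.rpow_add hx0]
    congr 1
    rw [hη, hD]
    field_simp
    ring
  have h1 := hK₁ x y hy1 hyx
  have h2 := hK₂ x y hy1 hyx
  have h3 := hK₃ x y hy1 hyx
  rw [hθ1, hθ2] at h1 h2 h3
  rw [hypConv_eq v h s hv0 hh0 hs hy1 hyx]
  have hβ1' : (1 - β) ≠ 0 := by linarith
  have hdecomp : (∑ n ∈ Finset.Icc 0 ⌊y⌋₊, v n * partialSum h ((x / n) ^ s⁻¹)) +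
      (∑ m ∈ Finset.Icc 0 ⌊(x / y) ^ s⁻¹⌋₊, h m * partialSum v (x / (m : ℝ) ^ s)) -
      partialSum v y * partialSum h ((x / y) ^ s⁻¹) - (a * hypH h s * x + b * abelConst v a β * x ^ β) =
      ((∑ n ∈ Finset.Icc 0 ⌊y⌋₊, v n * partialSum h ((x / n) ^ s⁻¹)) -
          (b * abelConst v a β * x ^ β + a * b / (1 - β) * (x ^ β * y ^ (1 - β)))) +
        ((∑ m ∈ Finset.Icc 0 ⌊(x / y) ^ s⁻¹⌋₊, h m * partialSum v (x / (m : ℝ) ^ s)) -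
          (a * hypH h s * x - a * b * β / (1 - β) * (x ^ β * y ^ (1 - β)))) -
        (partialSum v y * partialSum h ((x / y) ^ s⁻¹) - a * b * (x ^ β * y ^ (1 - β))) := by
    field_simp
    ring
  rw [hdecomp]
  set E1 : ℝ := (∑ n ∈ Finset.Icc 0 ⌊y⌋₊, v n * partialSum h ((x / n) ^ s⁻¹)) -
      (b * abelConst v a β * x ^ β + a * b / (1 - β) * (x ^ β * y ^ (1 - β))) with hE1
  set E2 : ℝ := (∑ m ∈ Finset.Icc 0 ⌊(x / y) ^ s⁻¹⌋₊, h m * partialSum v (x / (m : ℝ) ^ s)) -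
      (a * hypH h s * x - a * b * β / (1 - β) * (x ^ β * y ^ (1 - β))) with hE2
  set E3 : ℝ := partialSum v y * partialSum h ((x / y) ^ s⁻¹) - a * b * (x ^ β * y ^ (1 - β)) with hE3
  have hE12 := abs_add_le E1 E2
  have hE123 := abs_sub (E1 + E2) E3
  linarith

end Literature.NumberTheory.BeurlingPrimes
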